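import Summits.BirchSwinnertonDyer.BirchSwinnertonDyer.Theorems.EisensteinPrimesStrictEqUnramifiedCommutator
import Summits.BirchSwinnertonDyer.BirchSwinnertonDyer.Theorems.EisensteinPrimesGrSelmerQuotientCorankLe
import HarnessLib

/-!
# Crux 4's algebraic chain at a NON-SPLIT multiplicative Eisenstein prime READ ON THE UNRAMIFIED DUALS: a transfer principle
# `GrDualData ↔ DatumDualData` along `grSelmer = unrSelmer`, and `λ(𝔛^{Sf}_f) = λ(𝔛^{nr}_{θsub}) + λ(𝔛^{nr}_{θquot}) +
# Σ_{w∈Sf}(λ𝒫_w(θsub) + λ𝒫_w(θquot))` for the PRIMITIVE UNRAMIFIED character duals (the x1 cell's [BR] currency), mod PUB ×9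
# (cell `bsd-eis`, width seat `bsd-line-x2-p2` gen 8; crux 4 `BSDpOnCellC` stmt-BirchSwinnertonDyer-19034, line b1 v12 UNCHANGED)

WHY. The wall `stub_imprimitiveCount` of line b1 at a non-split `p ‖ N` is, after this seat, «PUB ×9 + hAN» with hAN = [AN∘BR]
(p659330); splitting hAN into the unprinted analytic comparison [AN] and Rubin's main conjecture [BR] requires [BR] in the currency
of hAN's `GrDualData … ∅ γ` (CGLS's STRICT primitive duals), whereas the cell's [BR] programme (x1: `CharMainConjOnTree`,
`IwasawaTwoVariable.charMainConj_conclusion_of_rubin`, KY Thm. 1.2.2 `Rubin Hida`) speaks about `GreenbergVatsal2000.DatumDualData`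
of `KellerYin2024.unrSelmer … ∅` (Keller–Yin's UNRAMIFIED primitive duals). By p660721 + p661243 the two Selmer groups COINCIDE for
both residual characters at a non-split multiplicative datum; this file turns that equality of groups into a transfer of
`Λ`-module statements between the two kinds of dual data (same underlying `X`), and restates the chain accordingly.

WHAT.
* §1 `GrDualData`/`DatumDualData` transfer (GENERIC discrete `M`, any `κ`, `v̄`, `S₀`, `γ`): along `h : grSelmer κ M v̄ S₀ = unrSelmer κ M v̄ S₀`
  every unramified dual datum `D` yields a strict dual datum with the SAME module `D.X` and conversely; packaged as
  `prop_datumDualData_of_forall_grDualData` / `prop_grDualData_of_forall_datumDualData`: a property of `Λ`-modules holding for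
  the `X` of every strict (resp. unramified) dual datum holds for the `X` of every unramified (resp. strict) one.
* §2 at a NON-SPLIT multiplicative Eisenstein datum (binders of g7's p654300 / this seat's p659748), for a residual pair and ANY
  UNRAMIFIED primitive dual data `D0sub`, `D0quot : DatumDualData κ γ (charModule ∅ θ) (bdpData …) ∅`:
  `unrDual_moduleFinite_isTorsion_mu_of_not_split_of_facts` — `D0.X` finitely generated, `Λ`-torsion, `μ = 0` (= the conclusion of
  Keller–Yin Thm. 1.2.2 `Rubin Hida` for both residual characters, here from CGLS Prop. 1.2.5's module clause [PUB] + kernel);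
  **`lambdaInvariant_xAc_eq_add_add_sum_unr_of_not_split_of_facts`** — `λ(XAc E_K p κ v̄ ↑Sf γ) = λ(D0sub.X) + λ(D0quot.X) +
  Σ_{w∈Sf}(charLocalLambda θsub w + charLocalLambda θquot w)` mod PUB ×9 ([ALG-imp] + [PWL-θ] on the unramified primitive duals).

HONEST FRAMING: tool/assembly theorems (no definition, no named fact, no `sorry`); §1 unconditional, §2 conditional BY NAME on PUBLISHED
facts (CGLS22 ×5, Greenberg ×4); closes no stub of v12; BSD / Mazur's MC / IMC proved for no curve.

References: [CastellaGrossiLeeSkinner2022] Thm. 1.2.2 (proof), Prop. 1.2.5, §1.4; [KellerYin2024] Thm. 1.2.2, Prop. 1.2.5, Thm. 1.4.1,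
Lemma 5.1.1 (arXiv:2402.12781v2); [GreenbergVatsal2000] §2 p. 17; [Greenberg1989] §1.
-/

set_option autoImplicit false
set_option linter.dupNamespace false -- the summit namespace `…BirchSwinnertonDyer.BirchSwinnertonDyer.Theorems` (Sub = Summit, D-0017) trips it

noncomputable section

open scoped Classical

namespace Summit.BirchSwinnertonDyer.BirchSwinnertonDyer.Theorems.StrictEqUnramifiedCentral

open NumberField IsDedekindDomain Field WeierstrassCurve
open Literature.NumberTheory.EllipticCurves Literature.NumberTheory.EllipticCurves.GreenbergSelmer
  Literature.NumberTheory.EllipticCurves.GreenbergVatsal2000 Literature.NumberTheory.GaloisRepresentations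
  Literature.NumberTheory.EllipticCurves.KellerYin2024 Literature.NumberTheory.EllipticCurves.IwasawaAlgebra
  Literature.NumberTheory.EllipticCurves.Castella2018.AcSelmer Literature.NumberTheory.EllipticCurves.Rank1Residual
  Literature.NumberTheory.EllipticCurves.CastellaGrossiLeeSkinner2022
  Literature.NumberTheory.IwasawaTheory Literature.NumberTheory.IwasawaTheory.Greenberg2016
  Literature.NumberTheory.IwasawaTheory.Greenberg2006

/-! ### §1 Transfer of dual data along `grSelmer = unrSelmer` -/

section Transfer

variable {K : Type} [Field K] [NumberField K] {p : ℕ} [hp : Fact p.Prime] (κ : ZpExtension K p)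
  {M : Type} [AddCommGroup M] [DistribMulAction (absoluteGaloisGroup K) M] [TopologicalSpace M]
  [DiscreteTopology M] (vbar : HeightOneSpectrum (𝓞 K)) (S₀ : Set (HeightOneSpectrum (𝓞 K)))
  {γ : absoluteGaloisGroup K}

/-- **Transfer, unramified → strict.** If `H¹_{𝓕_Gr^{S₀}}(K_∞, M) = H¹_{𝓕_nr^{S₀}}(K_∞, M)` as subgroups of `H¹(K_∞, M)`, then every
Pontryagin-dual datum `D` of the unramified group (`GreenbergVatsal2000.DatumDualData`, the x1 cell's / Keller–Yin's currency) IS a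
dual datum of the strict group (`KellerYin2024.GrDualData`, CGLS's currency) with the same `Λ`-module `D.X` (precompose `toDual` with the
identification; `T` still acts as `conj_γ − 1`, constants through `ℤ_p → ℤ/p^k`); hence any property of `Λ`-modules that holds for
the module of EVERY strict dual datum holds for `D.X`. [cite: GreenbergVatsal2000, §2 p. 17] [cite: KellerYin2024, §1.2 and Rem. 1.2.3 (arXiv:2402.12781v2)] -/
theorem prop_datumDualData_of_forall_grDualData (h : grSelmer κ M vbar S₀ = unrSelmer κ M vbar S₀)
    (P : ∀ (X : Type) [AddCommGroup X] [Module (IwasawaAlgebra p) X], Prop)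
    (hP : ∀ G : GrDualData κ M vbar S₀ γ, P G.X)
    (D : DatumDualData κ γ M (Castella2018.AcSelmer.bdpData M p vbar) S₀) : P D.X := by
  -- the two inclusions between the (equal) subgroups
  let e : ↥(grSelmer κ M vbar S₀) →+ ↥(unrSelmer κ M vbar S₀) := AddSubgroup.inclusion h.le
  let e' : ↥(unrSelmer κ M vbar S₀) →+ ↥(grSelmer κ M vbar S₀) := AddSubgroup.inclusion h.ge
  have hee' : ∀ t, e (e' t) = t := fun t ↦
    Subtype.ext (by rw [AddSubgroup.coe_inclusion, AddSubgroup.coe_inclusion])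
  have he'e : ∀ s, e' (e s) = s := fun s ↦
    Subtype.ext (by rw [AddSubgroup.coe_inclusion, AddSubgroup.coe_inclusion])
  let td : D.X →+ (grSelmer κ M vbar S₀ →+ AddCircle (1 : ℚ)) :=
    { toFun := fun x ↦ (D.toDual x).comp e
      map_zero' := by rw [map_zero, AddMonoidHom.zero_comp]
      map_add' := fun x y ↦ by rw [map_add, AddMonoidHom.add_comp] }
  have htd : ∀ x s, td x s = D.toDual x (e s) := fun _ _ ↦ rfl
  have hbij : Function.Bijective td := by
    constructor
    · intro x y hxy
      apply D.bijective.1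
      ext t
      rw [← hee' t, ← htd, ← htd, hxy]
    · intro χ
      obtain ⟨x, hx⟩ := D.bijective.2 (χ.comp e')
      refine ⟨x, ?_⟩
      ext s
      rw [htd, hx, AddMonoidHom.comp_apply, he'e]
  have hT : ∀ (x : D.X) (s : grSelmer κ M vbar S₀),
      td ((PowerSeries.X : IwasawaAlgebra p) • x) s = td x (conjGr κ M vbar S₀ γ s) - td x s := by
    intro x s
    have hes : (⟨conjH1 κ.kerSubgroup M γ (e s : unrSelmer κ M vbar S₀),
        conjH1_mem_datumSelmer κ.kerSubgroup M p _ S₀ γ (e s).2⟩ : unrSelmer κ M vbar S₀) =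
          e (conjGr κ M vbar S₀ γ s) := Subtype.ext (by
      change conjH1 κ.kerSubgroup M γ ((e s : unrSelmer κ M vbar S₀) : subgroupH1 κ.kerSubgroup M) =
        ((e (conjGr κ M vbar S₀ γ s) : unrSelmer κ M vbar S₀) : subgroupH1 κ.kerSubgroup M)
      rw [AddSubgroup.coe_inclusion, AddSubgroup.coe_inclusion, GrSelmerImprimitiveLambdaShift.coe_conjGr_apply])
    rw [htd, htd, htd, D.toDual_T_smul, hes]
  have hC : ∀ (c : ℤ_[p]) (x : D.X) (s : grSelmer κ M vbar S₀) (k : ℕ), (p ^ k) • s = 0 →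
      td (PowerSeries.C c • x) s = (PadicInt.toZModPow k c).val • td x s := by
    intro c x s k hk
    rw [htd, htd]
    exact D.toDual_C_smul c x (e s) k (by rw [← map_nsmul, hk, map_zero])
  exact hP { X := D.X, toDual := td, bijective := hbij, toDual_T_smul := hT, toDual_C_smul := hC }

/-- **Transfer, strict → unramified** (the converse of `prop_datumDualData_of_forall_grDualData`): along
`grSelmer κ M v̄ S₀ = unrSelmer κ M v̄ S₀`, every strict dual datum `G` IS an unramified dual datum with the same module `G.X`; hence a
property of `Λ`-modules holding for the module of every unramified dual datum holds for `G.X`.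
[cite: GreenbergVatsal2000, §2 p. 17] [cite: KellerYin2024, §1.2 and Rem. 1.2.3 (arXiv:2402.12781v2)] -/
theorem prop_grDualData_of_forall_datumDualData (h : grSelmer κ M vbar S₀ = unrSelmer κ M vbar S₀)
    (P : ∀ (X : Type) [AddCommGroup X] [Module (IwasawaAlgebra p) X], Prop)
    (hP : ∀ D : DatumDualData κ γ M (Castella2018.AcSelmer.bdpData M p vbar) S₀, P D.X)
    (G : GrDualData κ M vbar S₀ γ) : P G.X := by
  let e : ↥(unrSelmer κ M vbar S₀) →+ ↥(grSelmer κ M vbar S₀) := AddSubgroup.inclusion h.ge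
  let e' : ↥(grSelmer κ M vbar S₀) →+ ↥(unrSelmer κ M vbar S₀) := AddSubgroup.inclusion h.le
  have hee' : ∀ t, e (e' t) = t := fun t ↦
    Subtype.ext (by rw [AddSubgroup.coe_inclusion, AddSubgroup.coe_inclusion])
  have he'e : ∀ s, e' (e s) = s := fun s ↦
    Subtype.ext (by rw [AddSubgroup.coe_inclusion, AddSubgroup.coe_inclusion])
  let td : G.X →+ (unrSelmer κ M vbar S₀ →+ AddCircle (1 : ℚ)) :=
    { toFun := fun x ↦ (G.toDual x).comp e
      map_zero' := by rw [map_zero, AddMonoidHom.zero_comp]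
      map_add' := fun x y ↦ by rw [map_add, AddMonoidHom.add_comp] }
  have htd : ∀ x s, td x s = G.toDual x (e s) := fun _ _ ↦ rfl
  have hbij : Function.Bijective td := by
    constructor
    · intro x y hxy
      apply G.bijective.1
      ext t
      rw [← hee' t, ← htd, ← htd, hxy]
    · intro χ
      obtain ⟨x, hx⟩ := G.bijective.2 (χ.comp e')
      refine ⟨x, ?_⟩
      ext s
      rw [htd, hx, AddMonoidHom.comp_apply, he'e]
  have hT : ∀ (x : G.X) (s : unrSelmer κ M vbar S₀),
      td ((PowerSeries.X : IwasawaAlgebra p) • x) s =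
        td x ⟨conjH1 κ.kerSubgroup M γ s, conjH1_mem_datumSelmer κ.kerSubgroup M p _ S₀ γ s.2⟩ - td x s := by
    intro x s
    have hes : conjGr κ M vbar S₀ γ (e s) =
        e ⟨conjH1 κ.kerSubgroup M γ s, conjH1_mem_datumSelmer κ.kerSubgroup M p _ S₀ γ s.2⟩ := Subtype.ext (by
      rw [GrSelmerImprimitiveLambdaShift.coe_conjGr_apply, AddSubgroup.coe_inclusion, AddSubgroup.coe_inclusion])
    rw [htd, htd, htd, G.toDual_T_smul, hes]
  have hC : ∀ (c : ℤ_[p]) (x : G.X) (s : unrSelmer κ M vbar S₀) (k : ℕ), (p ^ k) • s = 0 →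
      td (PowerSeries.C c • x) s = (PadicInt.toZModPow k c).val • td x s := by
    intro c x s k hk
    rw [htd, htd]
    exact G.toDual_C_smul c x (e s) k (by rw [← map_nsmul, hk, map_zero])
  exact hP { X := G.X, toDual := td, bijective := hbij, toDual_T_smul := hT, toDual_C_smul := hC }

end Transfer

/-! ### §2 At a NON-SPLIT multiplicative Eisenstein datum: the chain on the UNRAMIFIED primitive duals -/

section Datum

variable {K : Type} [Field K] [NumberField K] {p : ℕ} [hp : Fact p.Prime]

/-- **Keller–Yin Thm. 1.2.2's CONCLUSION for both residual characters at a NON-SPLIT multiplicative Eisenstein datum, from CGLS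
Prop. 1.2.5 BY NAME**: for `θ ∈ {θsub, θquot}` and ANY dual datum `D0` of the PRIMITIVE UNRAMIFIED Selmer group
`H¹_{𝓕_nr}(K_∞, (F/𝒪)(θ))` (`DatumDualData … ∅`, Keller–Yin's `𝔛_θ = H¹_{𝓕_nr}(K, M_θ)^∨`), `D0.X` is finitely generated and `Λ`-torsion
with `μ = 0` — CGLS Prop. 1.2.5's module clause at `Sf` (`prop125_characterGrSelmerDual_torsion_muZero_dim`) + this seat's λ-shift
(p657642) give it for the strict primitive dual, and `grSelmer = unrSelmer` (p661243) transfers it (§1). Keller–Yin: «`H¹_{𝓕_nr}(K, M_θ)^∨`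
is a finitely generated `Λ`-torsion module with `μ`-invariant `0`» [Rubin, Hida]. [cite: KellerYin2024, Thm. 1.2.2 (Rubin Hida; arXiv:2402.12781v2 TeX L676–683)]
[cite: CastellaGrossiLeeSkinner2022, Thm. 1.2.2 and Prop. 1.2.5 (arXiv:2008.02571 Thm. 11, Prop. 14)] -/
theorem unrDual_moduleFinite_isTorsion_mu_of_not_split_of_facts
    (hprop125 : prop125_characterGrSelmerDual_torsion_muZero_dim) (hge : prop125_characterGrSelmerDual_corank_ge)
    (W : WeierstrassCurve ℚ) [W.IsElliptic] [W.IsGloballyMinimal]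
    (K : Type) [Field K] [NumberField K] (vbar : HeightOneSpectrum (𝓞 K))
    (κ : ZpExtension K p) (γ : absoluteGaloisGroup K) [hγ : Fact (κ.IsTopGenerator γ)]
    (Sf : Finset (HeightOneSpectrum (𝓞 K)))
    (hp2 : 2 < p) (hmult : Mult W p) (hns : ¬ W.HasSplitMultiplicativeReductionAtPrime p)
    (hK : IsImaginaryQuadratic K) (hH : SatisfiesHeegnerHypothesis (W.conductorNorm ℤ) K)
    (hsplit : ((Ideal.span {(p : ℤ)}).primesOver (𝓞 K)).ncard = 2)
    (hvbar : ((p : ℕ) : 𝓞 K) ∈ vbar.asIdeal) (hκ : κ.IsAnticyclotomic)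
    (hSf : ∀ w : HeightOneSpectrum (𝓞 K), w ∈ Sf ↔
      (((W.conductorNorm ℤ : ℤ) : 𝓞 K) ∈ w.asIdeal ∧ ((p : ℕ) : 𝓞 K) ∉ w.asIdeal))
    (θsub θquot : FramedGaloisRep K (padicCoeffIntegers (∅ : Set (PadicAlgCl p))) 1)
    (hpair : IsResidualPairOver (W.baseChange K) p θsub θquot)
    (θ : FramedGaloisRep K (padicCoeffIntegers (∅ : Set (PadicAlgCl p))) 1) (hθ : θ = θsub ∨ θ = θquot)
    (D0 : DatumDualData κ γ (charModule (∅ : Set (PadicAlgCl p)) θ)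
      (Castella2018.AcSelmer.bdpData (charModule (∅ : Set (PadicAlgCl p)) θ) p vbar) (∅ : Set (HeightOneSpectrum (𝓞 K)))) :
    Module.Finite (IwasawaAlgebra p) D0.X ∧ Module.IsTorsion (IwasawaAlgebra p) D0.X ∧ muInvariant p D0.X = 0 := by
  have heq := grSelmer_eq_unrSelmer_of_not_split κ vbar (∅ : Set (HeightOneSpectrum (𝓞 K))) θ W Sf hp2 hmult hns hK hH hsplit
    hvbar hSf θsub θquot hpair hθ
  obtain ⟨GS⟩ := nonempty_grDualData_char (∅ : Set (PadicAlgCl p)) θ κ vbar (↑Sf : Set (HeightOneSpectrum (𝓞 K))) hγ.out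
  refine prop_datumDualData_of_forall_grDualData κ vbar ∅ heq
    (fun (X : Type) [AddCommGroup X] [Module (IwasawaAlgebra p) X] ↦
      Module.Finite (IwasawaAlgebra p) X ∧ Module.IsTorsion (IwasawaAlgebra p) X ∧ muInvariant p X = 0)
    (fun G0 ↦ ?_) D0
  obtain ⟨h1, h2, h3, -, -⟩ := CharGrSelmerLambdaRelaxation.charLambdaRelaxation_of_not_split_of_facts hprop125 hge W K vbar κ γ Sf
    hp2 hmult hns hK hH hsplit hvbar hκ hSf θsub θquot hpair θ hθ GS G0
  exact ⟨h1, h2, h3⟩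

/-- **[ALG-imp] + [PWL-θ] ON THE UNRAMIFIED PRIMITIVE DUALS at a NON-SPLIT multiplicative Eisenstein datum, modulo PUBLISHED facts BY
NAME: `λ(𝔛^{Sf}_f) = λ(𝔛^{nr}_{θsub}) + λ(𝔛^{nr}_{θquot}) + Σ_{w∈Sf}(λ𝒫_w(θsub) + λ𝒫_w(θquot))`** — `𝔛^{Sf}_f = XAc E_K p κ v̄ ↑Sf γ`,
`𝔛^{nr}_θ = D0θ.X` for ANY dual data `D0θ : DatumDualData κ γ (charModule ∅ θ) (bdpData …) ∅` of the PRIMITIVE UNRAMIFIED groups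
(Keller–Yin's `𝔛_θ`; the objects of the x1 cell's `CharMainConjOnTree` / Rubin's main conjecture), `λ𝒫_w(θ) = charLocalLambda ∅ κ θ w`;
the nine facts as in `GrSelmerQuotientCorankLe.lambdaInvariant_xAc_eq_add_add_sum_of_not_split_of_facts` (p659748), from which this follows
by `grSelmer = unrSelmer` (p661243) and the transfer §1. [cite: KellerYin2024, Thm. 1.4.1, Prop. 1.2.5, Thm. 1.5.1 (arXiv:2402.12781v2)]
[cite: CastellaGrossiLeeSkinner2022, Prop. 1.2.5, §1.4, proof of Thm. 1.5.1 (eq:lambda-imp), proof of Thm. 1.2.2]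
[cite: Greenberg2016Selmer, Prop. 4.1.1] [cite: Greenberg2006, Props. 3.2, 4.1, 4.2] -/
theorem lambdaInvariant_xAc_eq_add_add_sum_unr_of_not_split_of_facts
    (hprop125 : prop125_characterGrSelmerDual_torsion_muZero_dim) (hge : prop125_characterGrSelmerDual_corank_ge)
    (hfact : prop14_residualCharacterSelmer_finite)
    (hlift : cor126_residualCharacter_globalLift) (hlocal : cor126_residualCharacter_localSurjective)
    (h411 : prop411_selmer_isAlmostDivisible) (h41 : prop41_globalEulerPoincareCorank)
    (h42 : prop42_localEulerPoincareCorank) (h32 : prop32_cohomology_isCofinitelyGenerated)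
    (W : WeierstrassCurve ℚ) [W.IsElliptic] [W.IsGloballyMinimal]
    (K : Type) [Field K] [NumberField K] {v : HeightOneSpectrum (𝓞 K)} (vbar : HeightOneSpectrum (𝓞 K))
    (κ : ZpExtension K p) (γ : absoluteGaloisGroup K) [Fact (κ.IsTopGenerator γ)]
    (Sf : Finset (HeightOneSpectrum (𝓞 K)))
    (hp2 : 2 < p) (hmult : Mult W p) (hns : ¬ W.HasSplitMultiplicativeReductionAtPrime p) (hred : Red W p)
    (hK : IsImaginaryQuadratic K) (hH : SatisfiesHeegnerHypothesis (W.conductorNorm ℤ) K)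
    (hsplit : ((Ideal.span {(p : ℤ)}).primesOver (𝓞 K)).ncard = 2)
    (hv : ((p : ℕ) : 𝓞 K) ∈ v.asIdeal) (hvbar : ((p : ℕ) : 𝓞 K) ∈ vbar.asIdeal) (hne : vbar ≠ v) (hκ : κ.IsAnticyclotomic)
    (hSf : ∀ w : HeightOneSpectrum (𝓞 K), w ∈ Sf ↔
      (((W.conductorNorm ℤ : ℤ) : 𝓞 K) ∈ w.asIdeal ∧ ((p : ℕ) : 𝓞 K) ∉ w.asIdeal))
    (θsub θquot : FramedGaloisRep K (padicCoeffIntegers (∅ : Set (PadicAlgCl p))) 1)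
    (hpair : IsResidualPairOver (W.baseChange K) p θsub θquot)
    (D0sub : DatumDualData κ γ (charModule (∅ : Set (PadicAlgCl p)) θsub)
      (Castella2018.AcSelmer.bdpData (charModule (∅ : Set (PadicAlgCl p)) θsub) p vbar) (∅ : Set (HeightOneSpectrum (𝓞 K))))
    (D0quot : DatumDualData κ γ (charModule (∅ : Set (PadicAlgCl p)) θquot)
      (Castella2018.AcSelmer.bdpData (charModule (∅ : Set (PadicAlgCl p)) θquot) p vbar) (∅ : Set (HeightOneSpectrum (𝓞 K)))) :
    lambdaInvariant p (XAc (W.baseChange K) p κ vbar (↑Sf : Set (HeightOneSpectrum (𝓞 K))) γ) =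
      lambdaInvariant p D0sub.X + lambdaInvariant p D0quot.X +
        ∑ w ∈ Sf, (charLocalLambda (∅ : Set (PadicAlgCl p)) κ θsub w + charLocalLambda (∅ : Set (PadicAlgCl p)) κ θquot w) := by
  have hsub := grSelmer_eq_unrSelmer_of_not_split κ vbar (∅ : Set (HeightOneSpectrum (𝓞 K))) θsub W Sf hp2 hmult hns hK hH
    hsplit hvbar hSf θsub θquot hpair (Or.inl rfl)
  have hquot := grSelmer_eq_unrSelmer_of_not_split κ vbar (∅ : Set (HeightOneSpectrum (𝓞 K))) θquot W Sf hp2 hmult hns hK hH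
    hsplit hvbar hSf θsub θquot hpair (Or.inr rfl)
  have hG : ∀ (Gs : GrDualData κ (charModule (∅ : Set (PadicAlgCl p)) θsub) vbar (∅ : Set (HeightOneSpectrum (𝓞 K))) γ)
      (Gq : GrDualData κ (charModule (∅ : Set (PadicAlgCl p)) θquot) vbar (∅ : Set (HeightOneSpectrum (𝓞 K))) γ),
      lambdaInvariant p (XAc (W.baseChange K) p κ vbar (↑Sf : Set (HeightOneSpectrum (𝓞 K))) γ) =
        lambdaInvariant p Gs.X + lambdaInvariant p Gq.X +
          ∑ w ∈ Sf, (charLocalLambda (∅ : Set (PadicAlgCl p)) κ θsub w + charLocalLambda (∅ : Set (PadicAlgCl p)) κ θquot w) :=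
    fun Gs Gq ↦ GrSelmerQuotientCorankLe.lambdaInvariant_xAc_eq_add_add_sum_of_not_split_of_facts hprop125 hge hfact hlift hlocal
      h411 h41 h42 h32 W K vbar κ γ Sf hp2 hmult hns hred hK hH hsplit hv hvbar hne hκ hSf θsub θquot hpair Gs Gq
  have h1 : ∀ Gq : GrDualData κ (charModule (∅ : Set (PadicAlgCl p)) θquot) vbar (∅ : Set (HeightOneSpectrum (𝓞 K))) γ,
      lambdaInvariant p (XAc (W.baseChange K) p κ vbar (↑Sf : Set (HeightOneSpectrum (𝓞 K))) γ) =
        lambdaInvariant p D0sub.X + lambdaInvariant p Gq.X +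
          ∑ w ∈ Sf, (charLocalLambda (∅ : Set (PadicAlgCl p)) κ θsub w + charLocalLambda (∅ : Set (PadicAlgCl p)) κ θquot w) :=
    fun Gq ↦ prop_datumDualData_of_forall_grDualData κ vbar ∅ hsub
      (fun (X : Type) [AddCommGroup X] [Module (IwasawaAlgebra p) X] ↦
        lambdaInvariant p (XAc (W.baseChange K) p κ vbar (↑Sf : Set (HeightOneSpectrum (𝓞 K))) γ) =
        lambdaInvariant p X + lambdaInvariant p Gq.X +
          ∑ w ∈ Sf, (charLocalLambda (∅ : Set (PadicAlgCl p)) κ θsub w + charLocalLambda (∅ : Set (PadicAlgCl p)) κ θquot w))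
      (fun Gs ↦ hG Gs Gq) D0sub
  exact prop_datumDualData_of_forall_grDualData κ vbar ∅ hquot
    (fun (Y : Type) [AddCommGroup Y] [Module (IwasawaAlgebra p) Y] ↦
      lambdaInvariant p (XAc (W.baseChange K) p κ vbar (↑Sf : Set (HeightOneSpectrum (𝓞 K))) γ) =
      lambdaInvariant p D0sub.X + lambdaInvariant p Y +
        ∑ w ∈ Sf, (charLocalLambda (∅ : Set (PadicAlgCl p)) κ θsub w + charLocalLambda (∅ : Set (PadicAlgCl p)) κ θquot w))
    h1 D0quot

end Datum

end Summit.BirchSwinnertonDyer.BirchSwinnertonDyer.Theorems.StrictEqUnramifiedCentral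

end
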